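import Mathlib
import Summits.Ventures.PercRepro.TriangleCapOffPairsCount

/-!
# PercRepro — the row `m = k + 1` of the `K₄⁻`-free cherry table: `Σ_v C(d(v), 2) ≤ C(k − 1, 2) + 4` for every
`K₄⁻`-free graph with `k + 1` edges on `k` vertices (p3, gen 30; part 3)

The census (the engine's `k4free.out`, rows `m = k + 1`) reads `10 · 14 · 19 · 25 · 32` at `k = 5 … 9`, i.e.
`C(k − 1, 2) + 4` = the star `K_{1,k−1}` plus two disjoint leaf edges.  For arbitrary graphs the maximum at
`m = k + 1` is one larger (the quasi-star: two leaf edges at a common leaf, `C(k − 1, 2) + 5`, Ahlswede–Katona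
1978); the `K₄⁻` condition — the neighbourhood of every vertex induces a matching — removes exactly that
configuration.  **`cherries_le_choose_two_add_four_of_k4mFree`** proves the `K₄⁻`-free bound for every `k`:
if every degree is `≤ 2` then `cherries ≤ m = k + 1`; otherwise at a vertex `v` of degree `d ≥ 3` the counts of
TriangleCapOffPairsCount give `2 Σ_x d(x)² + |R|·d ≤ 2d² + 2d + 2|R| + T' + |R|·m + |R|` with `T' = 4` when the
matching pairs are at most two and `T' = T ≤ min(d, |R|)` otherwise, and with `d = a + 3`, `m = a + 5 + e`,
`|R| = 2e + 4` this is `4·cherries ≤ 2(k − 1)(k − 2) + 16 − 4ae + (T' − 4)`, closed by `T' ≤ 4ae + 4`.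
The extremal graph (the star plus two disjoint leaf edges, `k ≥ 5`) is the companion module
TriangleCapStarPlusTwo.  Axioms: standard.
-/

namespace PercRepro

namespace TriangleCap

namespace C047

open Finset

variable {V : Type*} [Fintype V] [DecidableEq V]
/-- `k + 1 ≤ C(k − 1, 2) + 4` for every `k`. -/
theorem succ_le_choose_two_pred_add_four (k : ℕ) : k + 1 ≤ (k - 1).choose 2 + 4 := by
  have := le_choose_two_pred_add_two k
  omega

/-- **THE ROW `m = k + 1`:** every `K₄⁻`-free graph with `k + 1` edges on `k` vertices has
`Σ_v C(d(v), 2) ≤ C(k − 1, 2) + 4`. -/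
theorem cherries_le_choose_two_add_four_of_k4mFree (D : SimpleGraph V) [DecidableRel D.Adj]
    (hK : K4mFree D) (hm : D.edgeFinset.card = Fintype.card V + 1) :
    cherries D ≤ (Fintype.card V - 1).choose 2 + 4 := by
  by_cases hdeg : ∀ v, deg D v ≤ 2
  · -- every degree `≤ 2`: `2·cherries ≤ Σ d = 2m`
    have h1 : ∀ v, 2 * (deg D v).choose 2 ≤ deg D v := by
      intro v
      have := hdeg v
      interval_cases (deg D v) <;> decide
    have h2 : 2 * cherries D ≤ ∑ v, deg D v := by
      unfold cherries
      rw [mul_sum]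
      exact sum_le_sum (fun v _ => h1 v)
    rw [sum_deg_eq, hm] at h2
    have := succ_le_choose_two_pred_add_four (Fintype.card V)
    omega
  · push Not at hdeg
    obtain ⟨v, hv⟩ := hdeg
    -- the split of `2 Σ d²` (TriangleCapDiagonal) and the counts at `v`
    have hS := sum_adjPairsAll_deg_add D
    have hsplit1 := sum_filter_add_sum_filter_not (adjPairsAll D) (fun p => p.1 = v)
      (fun p => deg D p.1 + deg D p.2)
    have hsplit2 := sum_filter_add_sum_filter_not ((adjPairsAll D).filter (fun p => ¬ p.1 = v))
      (fun p => p.2 = v) (fun p => deg D p.1 + deg D p.2)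
    rw [filter_not_fst_filter_snd, filter_not_fst_filter_not_snd] at hsplit2
    have hfst := sum_filter_fst_deg_add D v
    have hsnd := sum_filter_snd_deg_add D v
    have hA := sum_deg_neighbors_eq D v
    have hE := two_mul_card_E_le D v
    have hT := card_T_le_deg D hK v
    have hTR : ((offPairs D v).filter (fun p => D.Adj v p.1 ∧ D.Adj v p.2)).card ≤
      (offPairs D v).card := card_filter_le _ _
    have hRc := two_mul_card_edges_eq D v
    have hR1 := sum_R_le D v
    have hc := two_mul_cherries_add D
    rw [sum_deg_eq] at hc
    have hdk : deg D v + 1 ≤ Fintype.card V := by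
      have hsub : univ.filter (fun w => D.Adj v w) ⊆ univ.erase v := by
        intro w hw
        rw [mem_filter] at hw
        rw [mem_erase]
        exact ⟨(D.ne_of_adj hw.2).symm, mem_univ _⟩
      have h1 : deg D v ≤ (univ.erase v).card := card_le_card hsub
      rw [card_erase_of_mem (mem_univ v), card_univ] at h1
      have h2 : 1 ≤ Fintype.card V := Fintype.card_pos_iff.mpr ⟨v⟩
      omega
    -- the combined linear bound (exact form)
    have hmain : 2 * (∑ x, deg D x * deg D x) + (offPairs D v).card * deg D v ≤
        2 * (deg D v * deg D v) + 2 * deg D v +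
          4 * ((offPairs D v).filter (fun p => D.Adj v p.1)).card +
          (offPairs D v).card * D.edgeFinset.card + (offPairs D v).card := by
      linarith [hS, hsplit1, hsplit2, hfst, hsnd, hA, hR1]
    -- names for the quantities
    set T := ((offPairs D v).filter (fun p => D.Adj v p.1 ∧ D.Adj v p.2)).card with hTdef
    set E := ((offPairs D v).filter (fun p => D.Adj v p.1)).card with hEdef
    set Rc := (offPairs D v).card with hRcdef
    set d := deg D v with hddef
    set m := D.edgeFinset.card with hmdef
    set k := Fintype.card V with hkdef
    set c := cherries D with hcdef
    set s2 := ∑ x, deg D x * deg D x with hs2def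
    -- the two regimes: few matching pairs / at least three
    by_cases h3 : 3 ≤ T
    · have hR2 := sum_R_le_of_three_le D hK v h3
      have hmain' : 2 * s2 + Rc * d + T ≤ 2 * (d * d) + 2 * d + 4 * E + Rc * m + Rc := by
        linarith [hS, hsplit1, hsplit2, hfst, hsnd, hA, hR2]
      clear_value T E Rc d m k c s2
      have hfin : 2 * s2 + Rc * d ≤ 2 * (d * d) + 2 * d + 2 * Rc + T + Rc * m + Rc := by
        linarith [hmain', hE]
      obtain ⟨a, rfl⟩ : ∃ a, d = a + 3 := ⟨d - 3, by omega⟩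
      obtain ⟨e, rfl⟩ : ∃ e, m = a + 5 + e := ⟨m - (a + 5), by omega⟩
      have hk' : k = a + 4 + e := by omega
      subst hk'
      have hRc' : Rc = 2 * e + 4 := by omega
      subst hRc'
      have e1 : a + 4 + e - 1 = a + 3 + e := by omega
      rw [e1]
      have hC := two_mul_choose_two_add (a + 3 + e)
      -- `T ≤ 4ae + 4` in each of the three regimes of `(a, e)`
      have hT4 : T ≤ 4 * (a * e) + 4 := by
        rcases Nat.eq_zero_or_pos a with ha | ha
        · subst ha
          omega
        · rcases Nat.eq_zero_or_pos e with he | he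
          · subst he
            omega
          · have hae : a ≤ a * e := Nat.le_mul_of_pos_right a he
            omega
      ring_nf at hfin hc hC ⊢
      linarith [hfin, hc, hC, hT4]
    · push Not at h3
      clear_value T E Rc d m k c s2
      have hfin : 2 * s2 + Rc * d ≤ 2 * (d * d) + 2 * d + 2 * Rc + 4 + Rc * m + Rc := by
        linarith [hmain, hE, h3]
      obtain ⟨a, rfl⟩ : ∃ a, d = a + 3 := ⟨d - 3, by omega⟩
      obtain ⟨e, rfl⟩ : ∃ e, m = a + 5 + e := ⟨m - (a + 5), by omega⟩
      have hk' : k = a + 4 + e := by omega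
      subst hk'
      have hRc' : Rc = 2 * e + 4 := by omega
      subst hRc'
      have e1 : a + 4 + e - 1 = a + 3 + e := by omega
      rw [e1]
      have hC := two_mul_choose_two_add (a + 3 + e)
      have hae := Nat.zero_le (a * e)
      ring_nf at hfin hc hC ⊢
      linarith [hfin, hc, hC, hae]

end C047

end TriangleCap

end PercRepro
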